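import Summits.Ventures.HodgeRepro2.T5SU11SphericalDecayFluxIdentity
import Summits.Ventures.HodgeRepro2.T5SU11KernelEnds

/-!
# The sharp sup bound of the kernel for `1 < λ ≤ 2`: `|K_λ(t, s)| ≤ χ_λ(max(t, s)) ≤ χ_λ(t)`, attained as `s → 0⁺`

For `1 < λ ≤ 2` the regular solution satisfies `0 < φ_λ ≤ 1` (row 238) and `χ_λ` is strictly decreasing (row 636); the explicit
formulas of row 624 then give

* `abs_kernel_le_sphDecay_max` — **`|K_λ(t, s)| ≤ χ_λ(max(t, s))`** for `t, s > 0`: the kernel decays like the decaying solution in the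
  larger variable, with no singularity issue in this form;
* `abs_kernel_le_sphDecay_fst` — **`|K_λ(t, s)| ≤ χ_λ(t)`** for every `s > 0`: the row's sup norm is at most `χ_λ(t)`;
* `tendsto_kernel_snd_nhdsGT_zero` — `K_λ(t, s) → −χ_λ(t)` as `s → 0⁺` (row 624 by symmetry): **the bound is sharp** — the row's
  sup norm is exactly `χ_λ(t)`, approached at the origin of the second variable;
* `abs_kernel_le_sphDecay_min` — the weaker `|K_λ(t, s)| ≤ χ_λ(min(t, s))`.

(For `λ ≥ 2` the corresponding statement is row 637's `|K_λ(t, s)| ≤ φ_λ(a_R) χ_λ(R)`, `R = max(t, s)`.) Nothing is claimed about (N).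

Blind lane: Mathlib + the HodgeRepro2 prefix only; no sorry; axioms ⊆ {propext, Classical.choice,
Quot.sound}.
-/

namespace Summit.Ventures.HodgeRepro2.T5SU11KernelSupBound

open Filter Topology MeasureTheory
open Set (Ioi)
open T5SU11Cartan T5SU11SphericalFunction T5SU11SphericalBounds T5SU11SphericalDecay T5SU11RadialGreenKernel
  T5SU11KernelEnds T5SU11SphericalDecayFluxIdentity

section measure

variable [MeasurableSpace Circle] [BorelSpace Circle]

variable {lam : ℝ} (hlam : 1 < lam) (h2 : lam ≤ 2)

include hlam h2 in
/-- **`|K_λ(t, s)| ≤ χ_λ(max(t, s))`** for `1 < λ ≤ 2` and `t, s > 0`. -/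
theorem abs_kernel_le_sphDecay_max {t s : ℝ} (ht : 0 < t) (hs : 0 < s) :
    |sphGreenKernel lam t s| ≤ sphDecay lam (max t s) := by
  have h0 : (0 : ℝ) ≤ lam := by linarith
  rcases le_total t s with hts | hst
  · rw [max_eq_right hts, kernel_eq_of_le lam hts, abs_neg, abs_of_pos (mul_pos (sphDecay_pos hlam hs) (sph_hyp_pos lam t))]
    have hφ : sph lam (hyp t) ≤ 1 := sph_hyp_le_one h0 h2 t
    have hχ : 0 < sphDecay lam s := sphDecay_pos hlam hs
    nlinarith
  · rw [max_eq_left hst, kernel_eq_of_ge lam hst, abs_neg, abs_of_pos (mul_pos (sph_hyp_pos lam s) (sphDecay_pos hlam ht))]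
    have hφ : sph lam (hyp s) ≤ 1 := sph_hyp_le_one h0 h2 s
    have hχ : 0 < sphDecay lam t := sphDecay_pos hlam ht
    nlinarith

include hlam h2 in
/-- **`|K_λ(t, s)| ≤ χ_λ(t)`** for `1 < λ ≤ 2` and every `s > 0`: the row's sup norm is at most `χ_λ(t)`. -/
theorem abs_kernel_le_sphDecay_fst {t s : ℝ} (ht : 0 < t) (hs : 0 < s) : |sphGreenKernel lam t s| ≤ sphDecay lam t := by
  refine le_trans (abs_kernel_le_sphDecay_max hlam h2 ht hs) ?_
  exact (sphDecay_strictAntiOn hlam).antitoneOn ht (lt_of_lt_of_le ht (le_max_left t s)) (le_max_left t s)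

include hlam h2 in
/-- The weaker bound `|K_λ(t, s)| ≤ χ_λ(min(t, s))` for `1 < λ ≤ 2`. -/
theorem abs_kernel_le_sphDecay_min {t s : ℝ} (ht : 0 < t) (hs : 0 < s) :
    |sphGreenKernel lam t s| ≤ sphDecay lam (min t s) := by
  refine le_trans (abs_kernel_le_sphDecay_max hlam h2 ht hs) ?_
  exact (sphDecay_strictAntiOn hlam).antitoneOn (lt_min ht hs) (lt_of_lt_of_le ht (le_max_left t s))
    (le_trans (min_le_left t s) (le_max_left t s))

/-- **`K_λ(t, s) → −χ_λ(t)` as `s → 0⁺`** (row 624 by symmetry): the bound `|K_λ(t, ·)| ≤ χ_λ(t)` is sharp. -/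
theorem tendsto_kernel_snd_nhdsGT_zero (lam : ℝ) {t : ℝ} (ht : 0 < t) :
    Tendsto (fun s => sphGreenKernel lam t s) (𝓝[>] 0) (𝓝 (-sphDecay lam t)) := by
  have h := tendsto_kernel_nhdsGT_zero lam ht
  refine h.congr' (Eventually.of_forall fun s => ?_)
  exact sphGreenKernel_symm lam s t

end measure

end Summit.Ventures.HodgeRepro2.T5SU11KernelSupBound
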